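import Summits.QuantumFields.BalabanUV.T4Continuum.Support.SubstrateCovariantAveraging
import Summits.QuantumFields.BalabanUV.T4Continuum.Support.SubstrateTwoRunsDriven
import Summits.QuantumFields.BalabanUV.T4Continuum.Support.B13OpDatum

/-!
# SUBSTRATE — THE RAW SPECIES AT A BACKGROUND: the V1 Green operator `G(U) = (Δ_U + a·Q(U)ᴴQ(U))⁻¹` and the unit-lattice covariance
# `C(U) = s·Q(U)·G(U)·Q(U)ᴴ` OF A GAUGE FIELD, the covariance READING shapes, the raw record built from a Green family, and the [dict]
# line D-6 «last coupling only» (MAP §O1 O-3 rows 2–3 + D-6; typed: `SubstrateSketch.v0.3` §RAW ∕ §D6)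

Cell `pub-balaban`, SUBSTRATE cell, seat `b2b-balaban-substrate-p1` («instances first»; typer NEXT (1) «`SubstrateRawSpecies` NOW»).  Summits-side
under the LEAN PLACEMENT RULE.  HONEST FRAMING: rung (B)+1 of the FINITE-VOLUME T⁴ programme — NOT infinite volume, NOT a mass gap, NOT Clay;
spine PROVED 0∕9.  DATA + definitional bookkeeping only: the operators are DEFINED (`Matrix` inverse = `nonsing_inv`, total; invertibility
of `Δ_U + aQᴴQ` is NOT claimed here — it is p3's S-GREEN coercivity at `U` near `1`), no decay, no estimate, nothing printed asserted.
HONEST DEPENDENCY (cell line, verbatim): continuum YM on T⁴ ⇐ BetaPertH ∧ nine spine estimates (0/9 proved); BetaPertH ⇐ (D1) ∧ (D4) ∧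
CAP+tail; G-an2-4 gates asym, D1 and NE2/3/4.

LEVEL CONVENTION (as in `SubstrateBackgroundTransporters.siteIdx`, p217365): V1 level `j` of the run `P` with `j + k = P.K` is NE2's
level `k` = `k` fine levels BELOW THE UNIT LATTICE `T_1` (V1 level `K`, `2·L^m` sites); `QcovOf P ι h Γ U` averages a level-`j` vector
field to the unit lattice.  The unit-lattice covariance below is therefore the covariance of the `k`-fold block average of the
level-`j` Gaussian field with covariance `G(U)` — NE2's `BalabanAveragedTowerUnit.unitCovB k` is its `U = 1` model ((1.68)–(1.69) of
[Balaban1984PropagatorsI] at `U = 1`); WHICH of Bałaban's step-indexed `C^{(k)}(U)` ([Balaban1987RG1] (2.12) p. 268,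
`C^{(k)} = (C*Δ^{(k)}C)⁻¹`) this models, and with which normalisation `s`, is the NE5 owner's reading (design R2 «unit-lattice kernel
species»); the constraint-elimination operator `C` and the gauge term are NOT included (S-GREEN ∕ S-Q territory) — HONEST.

WHAT.
* §1 `greenOf P ι h c a Γ U := (deltaQOf P ι h c a Γ U)⁻¹` and **`unitCovOf P ι h c a s Γ U := s • (Q(U) · G(U) · Q(U)ᴴ)`** on the
  unit-lattice vector-colour index `(Tor (unitMod P) × Fin d) × o` (k-INDEPENDENT type — what a `RawSpecies` slot needs); `U = 1`
  reductions BY NAME (`greenOf_one`, `unitCovOf_one`: NE2's free `(Δ ⊗ 1 + a(Q⊗1)ᴴ(Q⊗1))⁻¹` sandwiched by `Q ⊗ 1`); self-adjointness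
  for real `s` (`greenOf_conjTranspose`, `unitCovOf_conjTranspose`).
* §2 THE READING SHAPES (sketch §RAW verbatim): `ReadsCovAtA covAt rawA W`, `ReadsCovAtB tr covAt rawB W`, the Green-built record
  `rawOfGreen covAt dk gc pQ pR` and `readsCovAtA_rawOfGreen` (`rfl`).
* §3 THE COVARIANCE FAMILY OF RECORD of a run: at a FINEST-lattice configuration `U` (the carriers' `BgA`) and NE2 level `k ≤ K`, the
  background at V1 level `K − k` is the `(K−k)`-fold BLOCK AVERAGE `M^{K−k} U` ([Balaban1987RG1] (2.3) p. 265 «V^{(k)} = M^k(U_{k+1})»: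
  coarser backgrounds of a run ARE averages of the fine one — the TYPE; nothing asserted about minimisers), and
  **`covAtOfRecord P ι av c a s Γ U k`** := the entries of `unitCovOf` there (levels `k > K`: `0`); `covAtOfRecord_one`.
* §4 [dict] D-6 (sketch §D6 verbatim): `LastCouplingOnly raw`, `recOf raw`, `raw_succ_eq_recOf`; and **`rawOfRecord`** — the raw record
  whose `.cov` slot IS `covAtOfRecord` (coupling-IDLE) and whose other four species are LETTERS reading the coupling sequence ONLY at the
  last coupling `g k` at output level `k + 1` (`deltaKer`∕`gammaConstituent`: idle; `potQ`∕`potR`: functions of `(g k, U)`, Q-S8 (α)) —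
  so **`lastCouplingOnly_rawOfRecord`** holds BY CONSTRUCTION and `readsCovAtA_rawOfRecord` by `rfl`.  On the carriers of record
  (`D : DrivenRuns G`): `rawAOfRecord D …`, `rawBOfRecord D …` (run B one fine level deeper: torus `K + 1`) with the same two facts.
Imports `SubstrateCovariantAveraging` (p218826), `SubstrateTwoRunsDriven` (p217182), `B13OpDatum` (NE5 O1-b, p207653); nothing modified.
-/

noncomputable section

open scoped BigOperators Matrix Kronecker Matrix.Norms.L2Operator

namespace Summit.QuantumFields.BalabanUV.T4Continuum.SubstrateRawSpecies

open Literature.MathematicalPhysics.QuantumFieldTheory.Balaban1983to89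
open Literature.MathematicalPhysics.QuantumFieldTheory.Balaban1983to89.B5Prop11Plancherel (Tor fine)
open Literature.MathematicalPhysics.QuantumFieldTheory.Balaban1983to89.B5Block118 (QvOp)
open Literature.MathematicalPhysics.QuantumFieldTheory.Balaban1983to89.B5G183RateUnitTower (lev lev_neZero)
open Summit.QuantumFields.BalabanUV.T4Continuum.ColourCovariantLaplacian (lapC)
open Summit.QuantumFields.BalabanUV.T4Continuum.CovariantBlockAveraging (ContourSystem)
open Summit.QuantumFields.BalabanUV.T4Continuum.B13OpDatum (RawSpecies)
open Summit.QuantumFields.BalabanUV.T4Continuum.B13Carriers (TwoRuns)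
open Summit.QuantumFields.BalabanUV.T4Continuum.SubstrateBackgroundTransporters
open Summit.QuantumFields.BalabanUV.T4Continuum.SubstrateCovariantAveraging
open Summit.QuantumFields.BalabanUV.T4Continuum.SubstrateTwoRunsDriven (DrivenRuns)

/-! ## §1 The Green operator and the unit-lattice covariance of a gauge field -/

section Green

variable (P : Params) {G : Type*} [GaugeGroup G] {o : Type*} [Fintype o] [DecidableEq o] (ι : G →* Matrix o o ℂ)
variable {j k : ℕ} (h : j + k = P.K)

/-- [folklore] **`G(U) := (Δ_U + a·Q(U)ᴴQ(U))⁻¹`** on `ι`-valued vector fields of V1 level `j` (the (3.24)-type operator WITHOUT gauge term,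
`SubstrateCovariantAveraging.deltaQOf`, inverted by `Matrix`'s total inverse; invertibility NOT claimed here). -/
def greenOf (c : ℂ) (a : ℝ) (Γ : ContourSystem P.d (lev P.L k) (unitMod P)) (U : GaugeField P j G) :
    Matrix ((Tor (fine (lev P.L k) (unitMod P)) × Fin P.d) × o) ((Tor (fine (lev P.L k) (unitMod P)) × Fin P.d) × o) ℂ :=
  (deltaQOf P ι h c a Γ U)⁻¹

/-- [folklore] **`C(U) := s·Q(U)·G(U)·Q(U)ᴴ`** — THE UNIT-LATTICE COVARIANCE of the `k`-fold covariant block average of the level-`j` Gaussian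
field with covariance `G(U)`, normalisation `s` (the instancer's: NE2's `unitCovB` has `s = (L^d)^k`).  Its index
`(Tor (unitMod P) × Fin d) × o` does NOT depend on the level — a `RawSpecies` covariance slot can read it at every step. -/
def unitCovOf (c : ℂ) (a : ℝ) (s : ℂ) (Γ : ContourSystem P.d (lev P.L k) (unitMod P)) (U : GaugeField P j G) :
    Matrix ((Tor (unitMod P) × Fin P.d) × o) ((Tor (unitMod P) × Fin P.d) × o) ℂ :=
  s • (QcovOf P ι h Γ U * greenOf P ι h c a Γ U * (QcovOf P ι h Γ U)ᴴ)

/-- [folklore] `greenOf` unfolded. -/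
theorem greenOf_eq (c : ℂ) (a : ℝ) (Γ : ContourSystem P.d (lev P.L k) (unitMod P)) (U : GaugeField P j G) :
    greenOf P ι h c a Γ U = (deltaQOf P ι h c a Γ U)⁻¹ := rfl

/-- [folklore] AT `U = 1`: `G(1) = (Δ ⊗ 1 + a·(Q ⊗ 1)ᴴ(Q ⊗ 1))⁻¹` — NE2's free averaged operator, inverted (`deltaQOf_one` BY NAME). -/
theorem greenOf_one (c : ℂ) (a : ℝ) (Γ : ContourSystem P.d (lev P.L k) (unitMod P)) :
    greenOf P ι h c a Γ (1 : GaugeField P j G) =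
      (lapC (fine (lev P.L k) (unitMod P)) c +
        (a : ℂ) • ((QvOp (lev P.L k) (unitMod P) ⊗ₖ (1 : Matrix o o ℂ))ᴴ * (QvOp (lev P.L k) (unitMod P) ⊗ₖ (1 : Matrix o o ℂ))))⁻¹ := by
  rw [greenOf, deltaQOf_one]

/-- [folklore] AT `U = 1`: `C(1) = s·(Q ⊗ 1)·G(1)·(Q ⊗ 1)ᴴ` (`QcovOf_one`, `greenOf_one` BY NAME). -/
theorem unitCovOf_one (c : ℂ) (a : ℝ) (s : ℂ) (Γ : ContourSystem P.d (lev P.L k) (unitMod P)) :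
    unitCovOf P ι h c a s Γ (1 : GaugeField P j G) =
      s • ((QvOp (lev P.L k) (unitMod P) ⊗ₖ (1 : Matrix o o ℂ)) * greenOf P ι h c a Γ (1 : GaugeField P j G) *
        (QvOp (lev P.L k) (unitMod P) ⊗ₖ (1 : Matrix o o ℂ))ᴴ) := by
  rw [unitCovOf, QcovOf_one]

/-- [folklore] `G(U)` is self-adjoint (the inverse of a self-adjoint operator; `deltaQOf_conjTranspose`). -/
theorem greenOf_conjTranspose (c : ℂ) (a : ℝ) (Γ : ContourSystem P.d (lev P.L k) (unitMod P)) (U : GaugeField P j G) :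
    (greenOf P ι h c a Γ U)ᴴ = greenOf P ι h c a Γ U := by
  rw [greenOf, Matrix.conjTranspose_nonsing_inv, deltaQOf_conjTranspose]

/-- [folklore] For a REAL normalisation, `C(U)` is self-adjoint. -/
theorem unitCovOf_conjTranspose (c : ℂ) (a s : ℝ) (Γ : ContourSystem P.d (lev P.L k) (unitMod P)) (U : GaugeField P j G) :
    (unitCovOf P ι h c a (s : ℂ) Γ U)ᴴ = unitCovOf P ι h c a (s : ℂ) Γ U := by
  rw [unitCovOf, Matrix.conjTranspose_smul, Matrix.conjTranspose_mul, Matrix.conjTranspose_mul, Matrix.conjTranspose_conjTranspose,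
    greenOf_conjTranspose, Complex.star_def, Complex.conj_ofReal, ← Matrix.mul_assoc]

end Green

/-! ## §2 The covariance reading shapes and the Green-built raw record (sketch §RAW) -/

section Raw

variable {T κ ι' Ω 𝒴 : Type*} {Bg : Type*}

/-- [folklore] HYPOTHESIS SHAPE **`ReadsCovAtA covAt rawA W`**: run A's raw covariance entries on the coupling window ARE the entries of the
Green-operator family `covAt` (template `B13Readings.ReadsCovU1A`, now background-dependent). -/
def ReadsCovAtA (covAt : (ℕ → ℝ) → Bg → ℕ → T → κ → κ → ℂ) (rawA : (ℕ → ℝ) → Bg → ℕ → RawSpecies T κ ι' Ω 𝒴) (W : Set (ℕ → ℝ)) : Prop :=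
  ∀ k, ∀ g ∈ W, ∀ (U : Bg) (t : T) (a a' : κ), (rawA g U k).cov t a a' = covAt g U k t a a'

/-- [folklore] HYPOTHESIS SHAPE **`ReadsCovAtB tr covAt rawB W`**: run B's raw covariance entries at the PAIRED step are the family's entries
one fine level deeper, at the transported background `tr U`. -/
def ReadsCovAtB {BgB : Type*} (tr : BgB → Bg) (covAt : (ℕ → ℝ) → Bg → ℕ → T → κ → κ → ℂ)
    (rawB : (ℕ → ℝ) → BgB → ℕ → RawSpecies T κ ι' Ω 𝒴) (W : Set (ℕ → ℝ)) : Prop :=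
  ∀ k, ∀ g ∈ W, ∀ (U : BgB) (t : T) (a a' : κ), (rawB g U k).cov t a a' = covAt g (tr U) (k + 1) t a a'

/-- [folklore] DATA **`rawOfGreen`**: the raw record whose covariance species IS the Green family `covAt` and whose other species are the
given letter families. -/
def rawOfGreen (covAt : (ℕ → ℝ) → Bg → ℕ → T → κ → κ → ℂ) (dk : (ℕ → ℝ) → Bg → ℕ → T → ι' → ι' → ℂ)
    (gc : (ℕ → ℝ) → Bg → ℕ → T → κ → ι' → ℂ) (pQ : (ℕ → ℝ) → Bg → ℕ → Ω → 𝒴 → κ → κ → ℂ)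
    (pR : (ℕ → ℝ) → Bg → ℕ → Ω → 𝒴 → ℂ) : (ℕ → ℝ) → Bg → ℕ → RawSpecies T κ ι' Ω 𝒴 :=
  fun g U k => { cov := covAt g U k, deltaKer := dk g U k, gammaConstituent := gc g U k, potQ := pQ g U k, potR := pR g U k }

/-- [folklore] The Green-built raw record reads its own family (`rfl`). -/
theorem readsCovAtA_rawOfGreen (covAt : (ℕ → ℝ) → Bg → ℕ → T → κ → κ → ℂ) (dk : (ℕ → ℝ) → Bg → ℕ → T → ι' → ι' → ℂ)
    (gc : (ℕ → ℝ) → Bg → ℕ → T → κ → ι' → ℂ) (pQ : (ℕ → ℝ) → Bg → ℕ → Ω → 𝒴 → κ → κ → ℂ)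
    (pR : (ℕ → ℝ) → Bg → ℕ → Ω → 𝒴 → ℂ) (W : Set (ℕ → ℝ)) :
    ReadsCovAtA covAt (rawOfGreen (ι' := ι') (Ω := Ω) (𝒴 := 𝒴) covAt dk gc pQ pR) W :=
  fun _ _ _ _ _ _ _ => rfl

end Raw

/-! ## §3 The covariance family of record of a run: coarse backgrounds = block averages of the fine one -/

section Record

variable (P : Params) {G : Type*} [GaugeGroup G] {o : Type*} [Fintype o] [DecidableEq o] (ι : G →* Matrix o o ℂ)
variable (av : ∀ j, Averaging P j G) (c : ℂ) (a : ℝ) (s : ℕ → ℂ) (Γ : (k : ℕ) → ContourSystem P.d (lev P.L k) (unitMod P))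

/-- [folklore] **THE COVARIANCE FAMILY OF RECORD of a run** at a FINEST-lattice configuration `U`: at NE2 level `k ≤ K` the background of
record on V1 level `K − k` is the `(K−k)`-fold block average `M^{K−k} U` (coarser backgrounds of a run are averages of the fine one —
[Balaban1987RG1] (2.3) p. 265, the TYPE) and the entry `(b, b′)` is that of `unitCovOf` there (normalisation `s k`, contour system
`Γ k`); levels `k > K` (no V1 lattice): `0`.  Slot-blind in `T` (the slot resolution is NE5's). -/
def covAtOfRecord (U : GaugeField P 0 G) (k : ℕ) {T : Type*} (_t : T) (b b' : (Tor (unitMod P) × Fin P.d) × o) : ℂ :=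
  if hk : k ≤ P.K then
    unitCovOf P ι (j := P.K - k) (k := k) (by omega) c a (s k) (Γ k) (Averaging.iter av (P.K - k) U) b b'
  else 0

variable {P ι av c a s Γ}

/-- [folklore] In range, the covariance of record is the unit-lattice covariance at the averaged background (the definition). -/
theorem covAtOfRecord_of_le (U : GaugeField P 0 G) {k : ℕ} (hk : k ≤ P.K) {T : Type*} (t : T) (b b' : (Tor (unitMod P) × Fin P.d) × o) :
    covAtOfRecord P ι av c a s Γ U k t b b' =
      unitCovOf P ι (j := P.K - k) (k := k) (by omega) c a (s k) (Γ k) (Averaging.iter av (P.K - k) U) b b' := by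
  rw [covAtOfRecord, dif_pos hk]

/-- [folklore] Out of range the covariance of record vanishes. -/
theorem covAtOfRecord_of_lt (U : GaugeField P 0 G) {k : ℕ} (hk : P.K < k) {T : Type*} (t : T) (b b' : (Tor (unitMod P) × Fin P.d) × o) :
    covAtOfRecord P ι av c a s Γ U k t b b' = 0 := by
  rw [covAtOfRecord, dif_neg (not_le.mpr hk)]

/-- [folklore] The covariance of record is SLOT-BLIND. -/
theorem covAtOfRecord_slot (U : GaugeField P 0 G) (k : ℕ) {T : Type*} (t t' : T) (b b' : (Tor (unitMod P) × Fin P.d) × o) :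
    covAtOfRecord P ι av c a s Γ U k t b b' = covAtOfRecord P ι av c a s Γ U k t' b b' := by
  unfold covAtOfRecord
  rfl

end Record

/-! ## §4 [dict] D-6: last coupling only; the raw record of a run and of the driven runs -/

section D6

variable {Bg Sp : Type*}

/-- [folklore] HYPOTHESIS SHAPE **`LastCouplingOnly raw`** (sketch §D6 verbatim): at output scale `k + 1` the record reads the coupling sequence
only at `g k`. -/
def LastCouplingOnly (raw : (ℕ → ℝ) → Bg → ℕ → Sp) : Prop :=
  ∀ (g g' : ℕ → ℝ) (U : Bg) (k : ℕ), g k = g' k → raw g U (k + 1) = raw g' U (k + 1)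

/-- [folklore] DATA **`recOf raw`** (sketch §D6 verbatim): the canonical D-6 sourcing map `(k, s, U) ↦ raw (const s) U (k + 1)`. -/
def recOf (raw : (ℕ → ℝ) → Bg → ℕ → Sp) : ℕ → ℝ → Bg → Sp := fun k s U => raw (fun _ => s) U (k + 1)

/-- [folklore] Under `LastCouplingOnly` the record FACTORS through `recOf` at the last coupling (D-6's `hop` modulo NE5's `opOf`). -/
theorem raw_succ_eq_recOf {raw : (ℕ → ℝ) → Bg → ℕ → Sp} (h : LastCouplingOnly raw) (g : ℕ → ℝ) (U : Bg) (k : ℕ) :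
    raw g U (k + 1) = recOf raw k (g k) U :=
  h g (fun _ => g k) U k rfl

end D6

section RawRecord

variable (P : Params) {G : Type*} [GaugeGroup G] {o : Type*} [Fintype o] [DecidableEq o] (ι : G →* Matrix o o ℂ)
variable (av : ∀ j, Averaging P j G) (c : ℂ) (a : ℝ) (s : ℕ → ℂ) (Γ : (k : ℕ) → ContourSystem P.d (lev P.L k) (unitMod P))
variable {T ι' Ω 𝒴 : Type*}

/-- [folklore] **THE RAW RECORD OF A RUN**: `.cov` := the covariance family of record (coupling-IDLE); the other four species are LETTERS
reading ONLY the last coupling `g (k − 1)` at output level `k` (kernel letters `dk`, `gc`: functions of the background and the level;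
potential letters `pQ`, `pR`: functions of the last coupling, the background and the level — Q-S8 (α)).  MAP §O1 D-6′: `pR` (`potR`) := the
F^{(k)} ∕ 𝐏^{(k)}-derived OPERATOR part of 𝐕″_k ONLY; the history read-out Σ_Y 𝐕′_k of [Balaban1988RG2Cluster] Lemma 1 (1.33) enters ONLY
through `B13HistInsertion.InsDatum.slice` (table-borne), never through this record.  O-3′: the `.cov` slot is the ONE-STROKE model of the
fluctuation covariance (see `SubstrateCovariantAveraging.QcovOf`); equals print's composite at `U = 1`; composite = follower. -/
def rawOfRecord (dk : GaugeField P 0 G → ℕ → T → ι' → ι' → ℂ) (gc : GaugeField P 0 G → ℕ → T → ((Tor (unitMod P) × Fin P.d) × o) → ι' → ℂ)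
    (pQ : ℝ → GaugeField P 0 G → ℕ → Ω → 𝒴 → ((Tor (unitMod P) × Fin P.d) × o) → ((Tor (unitMod P) × Fin P.d) × o) → ℂ)
    (pR : ℝ → GaugeField P 0 G → ℕ → Ω → 𝒴 → ℂ) :
    (ℕ → ℝ) → GaugeField P 0 G → ℕ → RawSpecies T ((Tor (unitMod P) × Fin P.d) × o) ι' Ω 𝒴 :=
  rawOfGreen (fun _ U k => covAtOfRecord P ι av c a s Γ U k) (fun _ U k => dk U k) (fun _ U k => gc U k)
    (fun g U k => pQ (g (k - 1)) U k) (fun g U k => pR (g (k - 1)) U k)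

variable {dk : GaugeField P 0 G → ℕ → T → ι' → ι' → ℂ} {gc : GaugeField P 0 G → ℕ → T → ((Tor (unitMod P) × Fin P.d) × o) → ι' → ℂ}
  {pQ : ℝ → GaugeField P 0 G → ℕ → Ω → 𝒴 → ((Tor (unitMod P) × Fin P.d) × o) → ((Tor (unitMod P) × Fin P.d) × o) → ℂ}
  {pR : ℝ → GaugeField P 0 G → ℕ → Ω → 𝒴 → ℂ}

/-- [folklore] **D-6 FOR THE RAW RECORD, BY CONSTRUCTION**: the record reads the coupling sequence only at the last coupling. -/
theorem lastCouplingOnly_rawOfRecord : LastCouplingOnly (rawOfRecord P ι av c a s Γ dk gc pQ pR) := by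
  intro g g' U k hg
  simp only [rawOfRecord, rawOfGreen, Nat.add_sub_cancel, hg]

/-- [folklore] The raw record reads the covariance family of record (`rfl`). -/
theorem readsCovAtA_rawOfRecord (W : Set (ℕ → ℝ)) :
    ReadsCovAtA (fun _ U k => covAtOfRecord P ι av c a s Γ U k) (rawOfRecord P ι av c a s Γ dk gc pQ pR) W :=
  fun _ _ _ _ _ _ _ => rfl

/-- [folklore] The covariance slot of the raw record does not read the couplings AT ALL. -/
theorem rawOfRecord_cov_const (g g' : ℕ → ℝ) (U : GaugeField P 0 G) (k : ℕ) :
    (rawOfRecord P ι av c a s Γ dk gc pQ pR g U k).cov = (rawOfRecord P ι av c a s Γ dk gc pQ pR g' U k).cov := rfl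

end RawRecord

section Driven

variable {G : Type} [GaugeGroup G] {o : Type*} [Fintype o] [DecidableEq o] (ι : G →* Matrix o o ℂ) (D : DrivenRuns G)
variable (c : ℂ) (a : ℝ) (s : ℕ → ℂ) {T ι' Ω 𝒴 : Type*}

/-- [folklore] **RUN A's RAW RECORD ON THE CARRIERS OF RECORD** (torus `K`, averagings `D.avA`, admissible backgrounds `D.carriers.BgA`). -/
def rawAOfRecord (Γ : (k : ℕ) → ContourSystem (D.F.P D.K).d (lev (D.F.P D.K).L k) (unitMod (D.F.P D.K)))
    (dk : GaugeField (D.F.P D.K) 0 G → ℕ → T → ι' → ι' → ℂ)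
    (gc : GaugeField (D.F.P D.K) 0 G → ℕ → T → ((Tor (unitMod (D.F.P D.K)) × Fin (D.F.P D.K).d) × o) → ι' → ℂ)
    (pQ : ℝ → GaugeField (D.F.P D.K) 0 G → ℕ → Ω → 𝒴 → ((Tor (unitMod (D.F.P D.K)) × Fin (D.F.P D.K).d) × o) →
      ((Tor (unitMod (D.F.P D.K)) × Fin (D.F.P D.K).d) × o) → ℂ)
    (pR : ℝ → GaugeField (D.F.P D.K) 0 G → ℕ → Ω → 𝒴 → ℂ) :
    (ℕ → ℝ) → D.carriers.BgA → ℕ → RawSpecies T ((Tor (unitMod (D.F.P D.K)) × Fin (D.F.P D.K).d) × o) ι' Ω 𝒴 :=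
  fun g U k => rawOfRecord (D.F.P D.K) ι D.avA c a s Γ dk gc pQ pR g U.1 k

/-- [folklore] **RUN B's RAW RECORD** (torus `K + 1`, averagings `D.avB`, admissible backgrounds `D.carriers.BgB`). -/
def rawBOfRecord (Γ : (k : ℕ) → ContourSystem (D.F.P (D.K + 1)).d (lev (D.F.P (D.K + 1)).L k) (unitMod (D.F.P (D.K + 1))))
    (dk : GaugeField (D.F.P (D.K + 1)) 0 G → ℕ → T → ι' → ι' → ℂ)
    (gc : GaugeField (D.F.P (D.K + 1)) 0 G → ℕ → T → ((Tor (unitMod (D.F.P (D.K + 1))) × Fin (D.F.P (D.K + 1)).d) × o) → ι' → ℂ)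
    (pQ : ℝ → GaugeField (D.F.P (D.K + 1)) 0 G → ℕ → Ω → 𝒴 → ((Tor (unitMod (D.F.P (D.K + 1))) × Fin (D.F.P (D.K + 1)).d) × o) →
      ((Tor (unitMod (D.F.P (D.K + 1))) × Fin (D.F.P (D.K + 1)).d) × o) → ℂ)
    (pR : ℝ → GaugeField (D.F.P (D.K + 1)) 0 G → ℕ → Ω → 𝒴 → ℂ) :
    (ℕ → ℝ) → D.carriers.BgB → ℕ → RawSpecies T ((Tor (unitMod (D.F.P (D.K + 1))) × Fin (D.F.P (D.K + 1)).d) × o) ι' Ω 𝒴 :=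
  fun g U k => rawOfRecord (D.F.P (D.K + 1)) ι D.avB c a s Γ dk gc pQ pR g U.1 k

/-- [folklore] D-6 for run A's record on the carriers, by construction. -/
theorem lastCouplingOnly_rawAOfRecord (Γ : (k : ℕ) → ContourSystem (D.F.P D.K).d (lev (D.F.P D.K).L k) (unitMod (D.F.P D.K)))
    (dk : GaugeField (D.F.P D.K) 0 G → ℕ → T → ι' → ι' → ℂ)
    (gc : GaugeField (D.F.P D.K) 0 G → ℕ → T → ((Tor (unitMod (D.F.P D.K)) × Fin (D.F.P D.K).d) × o) → ι' → ℂ)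
    (pQ : ℝ → GaugeField (D.F.P D.K) 0 G → ℕ → Ω → 𝒴 → ((Tor (unitMod (D.F.P D.K)) × Fin (D.F.P D.K).d) × o) →
      ((Tor (unitMod (D.F.P D.K)) × Fin (D.F.P D.K).d) × o) → ℂ)
    (pR : ℝ → GaugeField (D.F.P D.K) 0 G → ℕ → Ω → 𝒴 → ℂ) : LastCouplingOnly (rawAOfRecord ι D c a s Γ dk gc pQ pR) :=
  fun g g' U k hg => lastCouplingOnly_rawOfRecord (D.F.P D.K) ι D.avA c a s Γ g g' U.1 k hg

/-- [folklore] D-6 for run B's record on the carriers, by construction. -/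
theorem lastCouplingOnly_rawBOfRecord (Γ : (k : ℕ) → ContourSystem (D.F.P (D.K + 1)).d (lev (D.F.P (D.K + 1)).L k) (unitMod (D.F.P (D.K + 1))))
    (dk : GaugeField (D.F.P (D.K + 1)) 0 G → ℕ → T → ι' → ι' → ℂ)
    (gc : GaugeField (D.F.P (D.K + 1)) 0 G → ℕ → T → ((Tor (unitMod (D.F.P (D.K + 1))) × Fin (D.F.P (D.K + 1)).d) × o) → ι' → ℂ)
    (pQ : ℝ → GaugeField (D.F.P (D.K + 1)) 0 G → ℕ → Ω → 𝒴 → ((Tor (unitMod (D.F.P (D.K + 1))) × Fin (D.F.P (D.K + 1)).d) × o) →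
      ((Tor (unitMod (D.F.P (D.K + 1))) × Fin (D.F.P (D.K + 1)).d) × o) → ℂ)
    (pR : ℝ → GaugeField (D.F.P (D.K + 1)) 0 G → ℕ → Ω → 𝒴 → ℂ) : LastCouplingOnly (rawBOfRecord ι D c a s Γ dk gc pQ pR) :=
  fun g g' U k hg => lastCouplingOnly_rawOfRecord (D.F.P (D.K + 1)) ι D.avB c a s Γ g g' U.1 k hg

end Driven

end Summit.QuantumFields.BalabanUV.T4Continuum.SubstrateRawSpecies

end
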